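import Mathlib
import HarnessLib
import Summits.NavierStokesRegularity.NavierStokesRegularity.Theorems.ThreadingFluxLoopLawBracketSlots

/-!
# VIRIAL HORN, W-ii (1/6): THE GENERATING-FUNCTION CALCULUS — the ring `ℂ[W,V,Z,s,t]`, its operators, parameters, coefficient extraction

Route `UnthreadedRigidityDoor`, item `UnthreadedRigidity` (W2, stmt-NavierStokesRegularity-27585) — LINE g11-1 «VIRIAL HORN»,
DIRECTOR-NS KEY-NS #210 (W-ii): the ALL-DEGREE BRACKET INJECTIVITY `bracketInjective_all` (= the hypothesis `hinj` of p712484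
`windowWedgeAnalyticL_of_bracketInjective`, every `l ≥ 1`), by a kernel road that needs neither the `SO(3)`-isotypic decomposition of `Λ²𝓗_l`
nor a closed form of Legendre coefficients (ns-crc-p2 g10; `--supports stmt-NavierStokesRegularity-27585`, helper; 0 kit).

CONTENT.  The 5-variable ring `GPoly = ℂ[W,V,Z,s,t]` (`s = X 3`, `t = X 4` are PARAMETERS), the inclusion `incl : ℂ[W,V,Z] → GPoly`
(`rename`), the operators `lapG = 4∂_W∂_V + ∂_Z²`, `dotG`, `lamG = W∂_W − V∂_V`, `tripleG` (the Lie–Poisson triple product, W1's `tripleC`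
formula) and the RAISING OPERATOR `raise = W∂_Z − 2Z∂_V = tripleC(W, ·)` (`raise_eq_tripleC`); compatibility of all of them with `incl`;
the bookkeeping predicate `IsParam` (killed by `∂_W, ∂_V, ∂_Z`) under which parameters factor out of every operator; Leibniz / product /
power rules (`dotG_pow_succ_left`, `lapG_mul`, `tripleG_pow_pow`); COEFFICIENT EXTRACTION along `incl` (`coeff_ext_incl_mul`,
`coeff_ext_sum_sum`): the coefficient of `incl(y^d) s^j t^k` in `Σ incl(a_{j'k'}) s^{j'} t^{k'}` is `coeff d a_{jk}` (the single-sum version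
and the weights `dg`, `ag` are in the next file `…CoherentFrame`).

HONEST LABEL: finite-dimensional polynomial algebra about solid harmonics (W1's complex-coordinate currency `Zonal.CPoly = ℂ[W,V,Z]`,
`tripleC = −i·det(∇·,∇·,x)`, `lapC`, imported by name — nothing is re-declared); no statement about Navier–Stokes solutions is made or
proved in this file; `UnthreadedRigidity` ⟨27585⟩, W2 and NS regularity remain OPEN.  [folklore]
-/

-- the summit and its single sub-problem share the name (CONVENTIONS §1)
set_option linter.dupNamespace false

noncomputable section

open MvPolynomial Finsupp

namespace Summit.NavierStokesRegularity.NavierStokesRegularity.Theorems.UnthreadedRigidity.VirialHorn.Coherent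

open Summit.NavierStokesRegularity.NavierStokesRegularity.Theorems.PoloidalLiouville.HorizonTower.Zonal
  (CPoly wt lapC lam tripleC dotC tri)

/-! ## The generating ring `ℂ[W,V,Z,s,t]` and the inclusion of `ℂ[W,V,Z]` -/

/-- polynomials in `W, V, Z` (variables `0,1,2`) and two parameters `s = X 3`, `t = X 4`. -/
abbrev GPoly : Type := MvPolynomial (Fin 5) ℂ

/-- the index embedding `Fin 3 → Fin 5`, `i ↦ i`. -/
def emb : Fin 3 → Fin 5 := Fin.castLE (by norm_num)

/-- `emb` is injective. -/
theorem emb_injective : Function.Injective emb := Fin.castLE_injective _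

/-- `emb 0 = 0`. -/
@[simp] theorem emb_zero : emb 0 = 0 := rfl
/-- `emb 1 = 1`. -/
@[simp] theorem emb_one : emb 1 = 1 := rfl
/-- `emb 2 = 2`. -/
@[simp] theorem emb_two : emb 2 = 2 := rfl

/-- the inclusion `incl : ℂ[W,V,Z] → ℂ[W,V,Z,s,t]`. -/
def incl : CPoly →ₐ[ℂ] GPoly := rename emb

/-- the inclusion on variables. -/
theorem incl_X (i : Fin 3) : incl (X i) = X (emb i) := rename_X _ _
/-- `incl W = W`. -/
@[simp] theorem incl_X_zero : incl (X 0) = X 0 := by rw [incl_X, emb_zero]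
/-- `incl V = V`. -/
@[simp] theorem incl_X_one : incl (X 1) = X 1 := by rw [incl_X, emb_one]
/-- `incl Z = Z`. -/
@[simp] theorem incl_X_two : incl (X 2) = X 2 := by rw [incl_X, emb_two]
/-- the inclusion on constants. -/
@[simp] theorem incl_C (c : ℂ) : incl (C c) = C c := rename_C _ _

/-- the inclusion is injective. -/
theorem incl_injective : Function.Injective incl := rename_injective _ emb_injective

/-- `∂_W, ∂_V, ∂_Z` commute with the inclusion. -/
theorem pderiv_incl (i : Fin 3) (P : CPoly) : pderiv (emb i) (incl P) = incl (pderiv i P) :=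
  pderiv_rename emb_injective i P

/-- `∂_W` commutes with the inclusion. -/
@[simp] theorem pderiv_zero_incl (P : CPoly) : pderiv 0 (incl P) = incl (pderiv 0 P) := by
  simpa using pderiv_incl 0 P
/-- `∂_V` commutes with the inclusion. -/
@[simp] theorem pderiv_one_incl (P : CPoly) : pderiv 1 (incl P) = incl (pderiv 1 P) := by
  simpa using pderiv_incl 1 P
/-- `∂_Z` commutes with the inclusion. -/
@[simp] theorem pderiv_two_incl (P : CPoly) : pderiv 2 (incl P) = incl (pderiv 2 P) := by
  simpa using pderiv_incl 2 P

/-! ## The operators on the generating ring -/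

/-- `Δ̃ = 4∂_W∂_V + ∂_Z²` on the generating ring (parameters untouched). -/
def lapG (F : GPoly) : GPoly := C (4 : ℂ) * pderiv 0 (pderiv 1 F) + pderiv 2 (pderiv 2 F)

/-- the bilinear gradient pairing `2(A_W B_V + A_V B_W) + A_Z B_Z` on the generating ring. -/
def dotG (A B : GPoly) : GPoly := C (2 : ℂ) * (pderiv 0 A * pderiv 1 B + pderiv 1 A * pderiv 0 B) + pderiv 2 A * pderiv 2 B

/-- the weight operator `Λ = W∂_W − V∂_V` on the generating ring. -/
def lamG (A : GPoly) : GPoly := X 0 * pderiv 0 A - X 1 * pderiv 1 A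

/-- the triple product (Lie–Poisson bracket) on the generating ring. -/
def tripleG (A B : GPoly) : GPoly :=
  pderiv 2 B * lamG A - pderiv 2 A * lamG B + C (2 : ℂ) * X 2 * (pderiv 1 A * pderiv 0 B - pderiv 0 A * pderiv 1 B)

/-- the RAISING derivation `E = tripleC (W, ·) = W∂_Z − 2Z∂_V` on `ℂ[W,V,Z]`. -/
def raise (P : CPoly) : CPoly := X 0 * pderiv 2 P - C (2 : ℂ) * X 2 * pderiv 1 P

/-- the raising derivation on the generating ring. -/
def raiseG (F : GPoly) : GPoly := X 0 * pderiv 2 F - C (2 : ℂ) * X 2 * pderiv 1 F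

/-- `E` is the bracket with `W`: `raise P = tripleC W P`. -/
theorem raise_eq_tripleC (P : CPoly) : raise P = tripleC (X 0) P := by
  unfold raise tripleC lam
  rw [pderiv_X_self, pderiv_X_of_ne (show (0 : Fin 3) ≠ 2 by decide), pderiv_X_of_ne (show (0 : Fin 3) ≠ 1 by decide)]
  ring

/-- `C 2 = 2` in the generating ring. -/
theorem C_two : (C (2 : ℂ) : GPoly) = 2 := map_ofNat C 2

/-- `C 4 = 4` in the generating ring. -/
theorem C_four : (C (4 : ℂ) : GPoly) = 4 := map_ofNat C 4

/-! ## Compatibility with the inclusion -/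

/-- `Δ̃` commutes with the inclusion. -/
theorem lapG_incl (P : CPoly) : lapG (incl P) = incl (lapC P) := by
  simp [lapG, lapC, map_add, map_mul]

/-- the gradient pairing commutes with the inclusion. -/
theorem dotG_incl (P Q : CPoly) : dotG (incl P) (incl Q) = incl (dotC P Q) := by
  simp [dotG, dotC, map_add, map_mul]

/-- the weight operator commutes with the inclusion. -/
theorem lamG_incl (P : CPoly) : lamG (incl P) = incl (lam P) := by
  simp [lamG, lam, map_sub, map_mul]

/-- the triple product commutes with the inclusion. -/
theorem tripleG_incl (P Q : CPoly) : tripleG (incl P) (incl Q) = incl (tripleC P Q) := by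
  simp [tripleG, tripleC, lamG_incl, map_add, map_sub, map_mul]

/-- the raising operator commutes with the inclusion. -/
theorem raiseG_incl (P : CPoly) : raiseG (incl P) = incl (raise P) := by
  simp [raiseG, raise, map_sub, map_mul]

/-! ## Parameters: polynomials in `s, t` are constants for the operators -/

/-- `F` is a PARAMETER polynomial: killed by `∂_W, ∂_V, ∂_Z` (e.g. any polynomial in `s, t`) — a bookkeeping predicate of this
file's calculus, not a cited statement. [folklore] -/
def IsParam (F : GPoly) : Prop := pderiv 0 F = 0 ∧ pderiv 1 F = 0 ∧ pderiv 2 F = 0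

/-- a parameter is killed by `∂_W`. -/
theorem IsParam.d0 {F : GPoly} (h : IsParam F) : pderiv 0 F = 0 := h.1
/-- a parameter is killed by `∂_V`. -/
theorem IsParam.d1 {F : GPoly} (h : IsParam F) : pderiv 1 F = 0 := h.2.1
/-- a parameter is killed by `∂_Z`. -/
theorem IsParam.d2 {F : GPoly} (h : IsParam F) : pderiv 2 F = 0 := h.2.2

/-- `s` is a parameter. -/
theorem isParam_X_three : IsParam (X 3 : GPoly) :=
  ⟨pderiv_X_of_ne (by decide), pderiv_X_of_ne (by decide), pderiv_X_of_ne (by decide)⟩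

/-- `t` is a parameter. -/
theorem isParam_X_four : IsParam (X 4 : GPoly) :=
  ⟨pderiv_X_of_ne (by decide), pderiv_X_of_ne (by decide), pderiv_X_of_ne (by decide)⟩

/-- constants are parameters. -/
theorem isParam_C (c : ℂ) : IsParam (C c : GPoly) := ⟨pderiv_C, pderiv_C, pderiv_C⟩

/-- parameters are closed under addition. -/
theorem IsParam.add {F G : GPoly} (hF : IsParam F) (hG : IsParam G) : IsParam (F + G) :=
  ⟨by rw [map_add, hF.d0, hG.d0, add_zero], by rw [map_add, hF.d1, hG.d1, add_zero],
    by rw [map_add, hF.d2, hG.d2, add_zero]⟩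

/-- parameters are closed under subtraction. -/
theorem IsParam.sub {F G : GPoly} (hF : IsParam F) (hG : IsParam G) : IsParam (F - G) :=
  ⟨by rw [map_sub, hF.d0, hG.d0, sub_zero], by rw [map_sub, hF.d1, hG.d1, sub_zero],
    by rw [map_sub, hF.d2, hG.d2, sub_zero]⟩

/-- parameters are closed under multiplication. -/
theorem IsParam.mul {F G : GPoly} (hF : IsParam F) (hG : IsParam G) : IsParam (F * G) :=
  ⟨by rw [pderiv_mul, hF.d0, hG.d0]; ring, by rw [pderiv_mul, hF.d1, hG.d1]; ring,
    by rw [pderiv_mul, hF.d2, hG.d2]; ring⟩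

/-- parameters are closed under powers. -/
theorem IsParam.pow {F : GPoly} (hF : IsParam F) (n : ℕ) : IsParam (F ^ n) := by
  induction n with
  | zero => simpa using isParam_C 1
  | succ n ih => rw [pow_succ]; exact ih.mul hF

/-- `∂_W (pF) = p ∂_W F` for a parameter `p`. -/
theorem IsParam.pderiv_mul_zero {p : GPoly} (hp : IsParam p) (F : GPoly) : pderiv 0 (p * F) = p * pderiv 0 F := by
  rw [pderiv_mul, hp.d0]; ring
/-- `∂_V (pF) = p ∂_V F` for a parameter `p`. -/
theorem IsParam.pderiv_mul_one {p : GPoly} (hp : IsParam p) (F : GPoly) : pderiv 1 (p * F) = p * pderiv 1 F := by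
  rw [pderiv_mul, hp.d1]; ring
/-- `∂_Z (pF) = p ∂_Z F` for a parameter `p`. -/
theorem IsParam.pderiv_mul_two {p : GPoly} (hp : IsParam p) (F : GPoly) : pderiv 2 (p * F) = p * pderiv 2 F := by
  rw [pderiv_mul, hp.d2]; ring

/-- `Δ̃ (pF) = p Δ̃F` for a parameter `p`. -/
theorem IsParam.lapG_mul {p : GPoly} (hp : IsParam p) (F : GPoly) : lapG (p * F) = p * lapG F := by
  simp only [lapG, hp.pderiv_mul_zero, hp.pderiv_mul_one, hp.pderiv_mul_two]; ring

/-- `Λ (pF) = p ΛF` for a parameter `p`. -/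
theorem IsParam.lamG_mul {p : GPoly} (hp : IsParam p) (F : GPoly) : lamG (p * F) = p * lamG F := by
  simp only [lamG, hp.pderiv_mul_zero, hp.pderiv_mul_one]; ring

/-- parameters factor out of the gradient pairing (left). -/
theorem IsParam.dotG_mul_left {p : GPoly} (hp : IsParam p) (F G : GPoly) : dotG (p * F) G = p * dotG F G := by
  simp only [dotG, hp.pderiv_mul_zero, hp.pderiv_mul_one, hp.pderiv_mul_two]; ring

/-- parameters factor out of the gradient pairing (right). -/
theorem IsParam.dotG_mul_right {p : GPoly} (hp : IsParam p) (F G : GPoly) : dotG F (p * G) = p * dotG F G := by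
  simp only [dotG, hp.pderiv_mul_zero, hp.pderiv_mul_one, hp.pderiv_mul_two]; ring

/-- parameters factor out of the triple product (left). -/
theorem IsParam.tripleG_mul_left {p : GPoly} (hp : IsParam p) (F G : GPoly) : tripleG (p * F) G = p * tripleG F G := by
  simp only [tripleG, hp.lamG_mul, hp.pderiv_mul_zero, hp.pderiv_mul_one, hp.pderiv_mul_two]; ring

/-- parameters factor out of the triple product (right). -/
theorem IsParam.tripleG_mul_right {p : GPoly} (hp : IsParam p) (F G : GPoly) : tripleG F (p * G) = p * tripleG F G := by
  simp only [tripleG, hp.lamG_mul, hp.pderiv_mul_zero, hp.pderiv_mul_one, hp.pderiv_mul_two]; ring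

/-- parameters factor out of the raising operator. -/
theorem IsParam.raiseG_mul {p : GPoly} (hp : IsParam p) (F : GPoly) : raiseG (p * F) = p * raiseG F := by
  simp only [raiseG, hp.pderiv_mul_one, hp.pderiv_mul_two]; ring

/-! ## Linearity, Leibniz and product rules -/

/-- `Δ̃` is additive. -/
theorem lapG_add (F G : GPoly) : lapG (F + G) = lapG F + lapG G := by
  simp only [lapG, map_add]; ring

/-- `Δ̃` over finite sums. -/
theorem lapG_sum {α : Type*} (s : Finset α) (F : α → GPoly) : lapG (∑ a ∈ s, F a) = ∑ a ∈ s, lapG (F a) := by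
  simp only [lapG, map_sum, Finset.mul_sum, Finset.sum_add_distrib]

/-- the gradient pairing is symmetric. -/
theorem dotG_comm (F G : GPoly) : dotG F G = dotG G F := by unfold dotG; ring

/-- the gradient pairing is additive (left). -/
theorem dotG_add_left (F G H : GPoly) : dotG (F + G) H = dotG F H + dotG G H := by
  simp only [dotG, map_add]; ring

/-- the gradient pairing respects subtraction (left). -/
theorem dotG_sub_left (F G H : GPoly) : dotG (F - G) H = dotG F H - dotG G H := by
  simp only [dotG, map_sub]; ring

/-- Leibniz rule for the gradient pairing in the first slot. -/
theorem dotG_mul_left (F G H : GPoly) : dotG (F * G) H = F * dotG G H + G * dotG F H := by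
  simp only [dotG, pderiv_mul]; ring

/-- power rule for the gradient pairing: `∇(F^{m+1})·∇H = (m+1) F^m ∇F·∇H`. -/
theorem dotG_pow_succ_left (F H : GPoly) (m : ℕ) : dotG (F ^ (m + 1)) H = ((m : GPoly) + 1) * F ^ m * dotG F H := by
  induction m with
  | zero => simp
  | succ m ih =>
    rw [pow_succ, dotG_mul_left, ih]
    push_cast
    ring

/-- product rule for the Laplacian: `Δ(FG) = ΔF·G + 2∇F·∇G + F·ΔG`. -/
theorem lapG_mul (F G : GPoly) : lapG (F * G) = lapG F * G + 2 * dotG F G + F * lapG G := by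
  simp only [lapG, dotG, pderiv_mul, map_add, C_two, C_four]
  ring

/-- the triple product is additive (left). -/
theorem tripleG_add_left (F G H : GPoly) : tripleG (F + G) H = tripleG F H + tripleG G H := by
  simp only [tripleG, lamG, map_add]; ring

/-- the triple product is additive (right). -/
theorem tripleG_add_right (F G H : GPoly) : tripleG F (G + H) = tripleG F G + tripleG F H := by
  simp only [tripleG, lamG, map_add]; ring

/-- the triple product over finite sums (left). -/
theorem tripleG_sum_left {α : Type*} (s : Finset α) (F : α → GPoly) (H : GPoly) :
    tripleG (∑ a ∈ s, F a) H = ∑ a ∈ s, tripleG (F a) H := by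
  classical
  induction s using Finset.induction_on with
  | empty => simp [tripleG, lamG]
  | insert a s ha ih => rw [Finset.sum_insert ha, Finset.sum_insert ha, tripleG_add_left, ih]

/-- the triple product over finite sums (right). -/
theorem tripleG_sum_right {α : Type*} (s : Finset α) (F : GPoly) (H : α → GPoly) :
    tripleG F (∑ a ∈ s, H a) = ∑ a ∈ s, tripleG F (H a) := by
  classical
  induction s using Finset.induction_on with
  | empty => simp [tripleG, lamG]
  | insert a s ha ih => rw [Finset.sum_insert ha, Finset.sum_insert ha, tripleG_add_right, ih]

/-- Leibniz power rule for the triple product: `{F^l, G^l} = l² F^{l−1} G^{l−1} {F, G}`. -/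
theorem tripleG_pow_pow (F G : GPoly) (l : ℕ) :
    tripleG (F ^ l) (G ^ l) = (l : GPoly) ^ 2 * F ^ (l - 1) * G ^ (l - 1) * tripleG F G := by
  simp only [tripleG, lamG, pderiv_pow]
  ring

/-- the raising operator is additive. -/
theorem raiseG_add (F G : GPoly) : raiseG (F + G) = raiseG F + raiseG G := by
  simp only [raiseG, map_add]; ring

/-- the raising operator over finite sums. -/
theorem raiseG_sum {α : Type*} (s : Finset α) (F : α → GPoly) : raiseG (∑ a ∈ s, F a) = ∑ a ∈ s, raiseG (F a) := by
  simp only [raiseG, map_sum, Finset.mul_sum, Finset.sum_sub_distrib]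

/-! ## Extraction of coefficients along the inclusion -/

/-- the exponent of `incl(y^d) · s^j · t^k`. -/
def ext (d : Fin 3 →₀ ℕ) (j k : ℕ) : Fin 5 →₀ ℕ := mapDomain emb d + single 3 j + single 4 k

/-- embedded exponents have no `s`. -/
theorem mapDomain_emb_apply_three (d : Fin 3 →₀ ℕ) : mapDomain emb d 3 = 0 :=
  mapDomain_notin_range _ _ (by rintro ⟨i, hi⟩; fin_cases i <;> simp [emb, Fin.castLE] at hi)

/-- embedded exponents have no `t`. -/
theorem mapDomain_emb_apply_four (d : Fin 3 →₀ ℕ) : mapDomain emb d 4 = 0 :=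
  mapDomain_notin_range _ _ (by rintro ⟨i, hi⟩; fin_cases i <;> simp [emb, Fin.castLE] at hi)

/-- the `s`-exponent of `ext d j k` is `j`. -/
@[simp] theorem ext_three (d : Fin 3 →₀ ℕ) (j k : ℕ) : ext d j k 3 = j := by
  simp [ext, mapDomain_emb_apply_three]

/-- the `t`-exponent of `ext d j k` is `k`. -/
@[simp] theorem ext_four (d : Fin 3 →₀ ℕ) (j k : ℕ) : ext d j k 4 = k := by
  simp [ext, mapDomain_emb_apply_four]

/-- monomials `s^j t^k`. -/
theorem X_pow_mul_X_pow_eq_monomial (j k : ℕ) :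
    (X 3 : GPoly) ^ j * X 4 ^ k = monomial (single 3 j + single 4 k) 1 := by
  rw [X_pow_eq_monomial, X_pow_eq_monomial, monomial_mul, mul_one]

/-- COEFFICIENT EXTRACTION: the coefficient of `incl(y^d) s^j t^k` in `incl(P) · s^{j'} t^{k'}`. -/
theorem coeff_ext_incl_mul (d : Fin 3 →₀ ℕ) (j k j' k' : ℕ) (P : CPoly) :
    coeff (ext d j k) (incl P * X 3 ^ j' * X 4 ^ k') = if j' = j ∧ k' = k then coeff d P else 0 := by
  classical
  rw [mul_assoc, X_pow_mul_X_pow_eq_monomial, coeff_mul_monomial', mul_one]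
  by_cases hle : single 3 j' + single 4 k' ≤ ext d j k
  · rw [if_pos hle]
    have hj : j' ≤ j := by have := hle 3; simpa [single_apply] using this
    have hk : k' ≤ k := by have := hle 4; simpa [single_apply] using this
    by_cases heq : j' = j ∧ k' = k
    · obtain ⟨rfl, rfl⟩ := heq
      rw [if_pos ⟨rfl, rfl⟩]
      have : ext d j' k' - (single 3 j' + single 4 k') = mapDomain emb d := by
        rw [ext, add_assoc, add_tsub_cancel_right]
      rw [this, incl, coeff_rename_mapDomain _ emb_injective]
    · rw [if_neg heq]
      apply coeff_rename_eq_zero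
      intro u hu
      exfalso
      apply heq
      have h3 := congrArg (fun e => e 3) hu
      have h4 := congrArg (fun e => e 4) hu
      simp only [mapDomain_emb_apply_three, mapDomain_emb_apply_four, Finsupp.coe_tsub, Pi.sub_apply, ext_three,
        ext_four, Finsupp.coe_add, Pi.add_apply, single_apply] at h3 h4
      simp at h3 h4
      omega
  · rw [if_neg hle, if_neg]
    rintro ⟨rfl, rfl⟩
    apply hle
    intro i
    simp only [ext, Finsupp.coe_add, Pi.add_apply]
    omega

/-- extraction from a finite double sum `Σ_{j,k < N} incl(a j k) s^j t^k`. -/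
theorem coeff_ext_sum_sum (N : ℕ) (a : ℕ → ℕ → CPoly) (d : Fin 3 →₀ ℕ) {j k : ℕ} (hj : j < N) (hk : k < N) :
    coeff (ext d j k) (∑ j' ∈ Finset.range N, ∑ k' ∈ Finset.range N, incl (a j' k') * X 3 ^ j' * X 4 ^ k') = coeff d (a j k) := by
  classical
  simp only [coeff_sum, coeff_ext_incl_mul]
  rw [Finset.sum_eq_single j, Finset.sum_eq_single k]
  · simp
  · intro k' _ hk'; simp [hk']
  · intro h; exact absurd (Finset.mem_range.mpr hk) h
  · intro j' _ hj'; simp [hj']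
  · intro h; exact absurd (Finset.mem_range.mpr hj) h


end Summit.NavierStokesRegularity.NavierStokesRegularity.Theorems.UnthreadedRigidity.VirialHorn.Coherent

end
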